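import Summits.QuantumFields.YangMills.Theorems.LangevinControlUVFemtoCurvatureSkewnessCRatioTransportDefs

/-!
# Crux `FemtoCurvatureSkewnessC` (stmt-QuantumFields-16205), line `ratio-transport`: the three transport chains

Lead `prover-line-stmt-QuantumFields-16205-0` (2026-08-16).  Helper file of the composition stub `stub_ratioFloorOfTransports`
(the dyadic descent, `LangevinControlUVFemtoCurvatureSkewnessCStubRatioFloorOfTransports.lean`), over the route-posited
vocabulary `skewRatioT` of `LangevinControlUVFemtoCurvatureSkewnessCRatioTransportDefs.lean`.  Pure real analysis — no property
of `skewRatioT` is used; the transport hypotheses enter unbundled (with their constants), exactly as the clauses of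
`SeparationTransport`, `VolumeTransport`, `CutoffTransport`:

* `abs_sub_le_sum_of_steps` — telescoping of absolute differences;
* `sep_chain` — (S) `C_S/m`-steps from `n'` to `n' + d` at fixed `(L, β)` cost `≤ C_S d/n'`;
* `vol_chain` — (V) dyadic telescoping of the DIFFERENTIAL volume transport: from `M₀ ≥ 8n'` to any `M ∈ [M₀, L]` inside a femto
  box the ratio moves by `≤ 2 C_V (n'/M₀)⁴` (one step if `M ≤ 2M₀`, else double `M₀` and recurse: `1 + 2/16 ≤ 2`);
* `cut_chain` — (C) `k` cutoff halvings along couplings `βj i` with `a(βj i) = 2^{k-i} a(β)` cost `≤ Σ_{i<k} ε(2^i n₀)`;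
* `dyadic_split` — the bookkeeping `k := log₂⌊n/N₀⌋`, `n₀ := ⌊n/2^k⌋`: `2^k ≤ n < 2^{k+1}N₀`, `1 ≤ n₀ < 2N₀`, `k = 0 ∨ N₀ ≤ n₀`,
  `2^k n₀ ≤ n < 2^k n₀ + 2^k`.
-/

set_option autoImplicit false

noncomputable section

namespace Summit.QuantumFields.YangMills.Cruxes.FemtoCurvatureSkewnessC.RatioTransport

open MeasureTheory Filter Topology
open scoped BigOperators
open Literature.MathematicalPhysics.QuantumFieldTheory

/-! ## Helpers: telescoping and dyadic bookkeeping -/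

/-- Telescoping of absolute differences along `0, 1, …, N`. -/
theorem abs_sub_le_sum_of_steps (f b : ℕ → ℝ) (N : ℕ) (h : ∀ j < N, |f (j + 1) - f j| ≤ b j) :
    |f N - f 0| ≤ ∑ j ∈ Finset.range N, b j := by
  induction N with
  | zero => simp
  | succ N ih =>
    rw [Finset.sum_range_succ]
    have h1 : |f (N + 1) - f N| ≤ b N := h N (Nat.lt_succ_self N)
    have h2 : |f N - f 0| ≤ ∑ j ∈ Finset.range N, b j := ih fun j hj => h j (Nat.lt_succ_of_lt hj)
    calc |f (N + 1) - f 0| = |(f (N + 1) - f N) + (f N - f 0)| := by ring_nf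
      _ ≤ |f (N + 1) - f N| + |f N - f 0| := abs_add_le _ _
      _ ≤ b N + ∑ j ∈ Finset.range N, b j := add_le_add h1 h2
      _ = ∑ j ∈ Finset.range N, b j + b N := add_comm _ _

section Chains

variable {G : Type} [Group G] [TopologicalSpace G] [IsTopologicalGroup G] [CompactSpace G]
  [MeasurableSpace G] [BorelSpace G]

/-- **Separation chain**: `C_S/m`-steps from `n'` up to `n` at fixed `(L, β)` cost at most `C_S (n − n')/n'`. -/
theorem sep_chain (r : LatticeRep G) (a : ℝ → ℝ) {βs ℓs CS : ℝ} (hCS : 0 ≤ CS)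
    (hsep : ∀ (L : ℕ) [NeZero L] (β : ℝ) (n : ℕ), βs ≤ β → (L : ℝ) * a β ≤ ℓs →
      1 ≤ n → 8 * (n + 1) ≤ L → |skewRatioT r L β (n + 1) - skewRatioT r L β n| ≤ CS / n)
    (L : ℕ) [NeZero L] (β : ℝ) (hβ : βs ≤ β) (hL : (L : ℝ) * a β ≤ ℓs)
    (n' : ℕ) (hn' : 1 ≤ n') (d : ℕ) (h8 : 8 * (n' + d) ≤ L) :
    |skewRatioT r L β (n' + d) - skewRatioT r L β n'| ≤ CS * d / n' := by
  have hn'pos : (0 : ℝ) < n' := by exact_mod_cast hn'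
  have key := abs_sub_le_sum_of_steps (fun j => skewRatioT r L β (n' + j)) (fun _ => CS / n') d ?_
  · calc _ ≤ ∑ j ∈ Finset.range d, CS / (n' : ℝ) := key
      _ = CS * d / n' := by rw [Finset.sum_const, Finset.card_range, nsmul_eq_mul]; ring
  · intro j hj
    have hstep := hsep L β (n' + j) hβ hL (by omega) (by omega)
    have hle : CS / ((n' + j : ℕ) : ℝ) ≤ CS / n' := by
      apply div_le_div_of_nonneg_left hCS hn'pos
      exact_mod_cast Nat.le_add_right n' j
    simpa [Nat.add_assoc] using hstep.trans hle

/-- **Volume chain** (dyadic telescoping of the differential volume transport): from `M₀ ≥ 8n'` up to any `M ∈ [M₀, L]`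
inside a femto box the ratio moves by at most `2 C_V (n'/M₀)⁴`. -/
theorem vol_chain (r : LatticeRep G) (a : ℝ → ℝ) {βv ℓv CV : ℝ} (hCV : 0 ≤ CV)
    (hvol : ∀ (L L' : ℕ) [NeZero L] [NeZero L'] (β : ℝ) (n : ℕ), βv ≤ β → (L : ℝ) * a β ≤ ℓv →
      1 ≤ n → 8 * n ≤ L' → L' ≤ L → L ≤ 2 * L' →
        |skewRatioT r L β n - skewRatioT r L' β n| ≤ CV * ((n : ℝ) / L') ^ 4 * (((L : ℝ) - L') / L'))
    (L : ℕ) (β : ℝ) (hβ : βv ≤ β) (hL : (L : ℝ) * a β ≤ ℓv) (hapos : 0 < a β) (n' : ℕ) (hn' : 1 ≤ n') :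
    ∀ (d : ℕ) (M₀ M : ℕ) [NeZero M₀] [NeZero M], M - M₀ ≤ d → 8 * n' ≤ M₀ → M₀ ≤ M → M ≤ L →
      |skewRatioT r M β n' - skewRatioT r M₀ β n'| ≤ 2 * CV * ((n' : ℝ) / M₀) ^ 4 := by
  intro d
  induction d using Nat.strong_induction_on with
  | _ d ih =>
    intro M₀ M _ _ hd h8 hM₀M hML
    have hM₀pos : (0 : ℝ) < M₀ := by exact_mod_cast (show 0 < M₀ by omega)
    have hMfemto : (M : ℝ) * a β ≤ ℓv :=
      le_trans (mul_le_mul_of_nonneg_right (by exact_mod_cast hML) hapos.le) hL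
    have hX : 0 ≤ CV * ((n' : ℝ) / M₀) ^ 4 := by positivity
    by_cases hsmall : M ≤ 2 * M₀
    · -- one differential step
      have h := hvol M M₀ β n' hβ hMfemto hn' h8 hM₀M hsmall
      have hfrac : ((M : ℝ) - M₀) / M₀ ≤ 1 := by
        rw [div_le_one hM₀pos]
        have : (M : ℝ) ≤ 2 * M₀ := by exact_mod_cast hsmall
        linarith
      have hfrac0 : 0 ≤ ((M : ℝ) - M₀) / M₀ :=
        div_nonneg (by rw [sub_nonneg]; exact_mod_cast hM₀M) hM₀pos.le
      calc |skewRatioT r M β n' - skewRatioT r M₀ β n'|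
          ≤ CV * ((n' : ℝ) / M₀) ^ 4 * (((M : ℝ) - M₀) / M₀) := h
        _ ≤ CV * ((n' : ℝ) / M₀) ^ 4 * 1 := mul_le_mul_of_nonneg_left hfrac hX
        _ ≤ 2 * CV * ((n' : ℝ) / M₀) ^ 4 := by linarith
    · -- double `M₀` once and recurse
      replace hsmall : 2 * M₀ < M := not_le.1 hsmall
      haveI : NeZero (2 * M₀) := ⟨by omega⟩
      have hrec : |skewRatioT r M β n' - skewRatioT r (2 * M₀) β n'| ≤
          2 * CV * ((n' : ℝ) / (2 * M₀ : ℕ)) ^ 4 :=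
        ih (M - 2 * M₀) (by omega) (2 * M₀) M le_rfl (by omega) hsmall.le hML
      have h2femto : ((2 * M₀ : ℕ) : ℝ) * a β ≤ ℓv :=
        le_trans (mul_le_mul_of_nonneg_right (by exact_mod_cast (show 2 * M₀ ≤ L by omega)) hapos.le) hL
      have hone := hvol (2 * M₀) M₀ β n' hβ h2femto hn' h8 (by omega) le_rfl
      have hfrac : (((2 * M₀ : ℕ) : ℝ) - M₀) / M₀ = 1 := by
        rw [div_eq_one_iff_eq hM₀pos.ne']; push_cast; ring
      rw [hfrac, mul_one] at hone
      have hscale : ((n' : ℝ) / (2 * M₀ : ℕ)) ^ 4 = ((n' : ℝ) / M₀) ^ 4 / 16 := by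
        push_cast
        rw [show (n' : ℝ) / (2 * (M₀ : ℝ)) = (n' : ℝ) / M₀ / 2 by ring, div_pow]
        norm_num
      rw [hscale] at hrec
      calc |skewRatioT r M β n' - skewRatioT r M₀ β n'|
          = |(skewRatioT r M β n' - skewRatioT r (2 * M₀) β n') +
              (skewRatioT r (2 * M₀) β n' - skewRatioT r M₀ β n')| := by ring_nf
        _ ≤ |skewRatioT r M β n' - skewRatioT r (2 * M₀) β n'| +
              |skewRatioT r (2 * M₀) β n' - skewRatioT r M₀ β n'| := abs_add_le _ _
        _ ≤ 2 * CV * (((n' : ℝ) / M₀) ^ 4 / 16) + CV * ((n' : ℝ) / M₀) ^ 4 := add_le_add hrec hone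
        _ ≤ 2 * CV * ((n' : ℝ) / M₀) ^ 4 := by nlinarith [hX]

/-- **Cutoff chain**: `k` halvings along couplings `βj 0, …, βj k` with `a (βj i) = 2^(k-i) · a(β)` cost at most
`Σ_{i<k} ε(2^i n₀)`. -/
theorem cut_chain (r : LatticeRep G) (a : ℝ → ℝ) {βc ℓc : ℝ} {ε : ℕ → ℝ}
    (hstep : ∀ (L L' : ℕ) [NeZero L] [NeZero L'] (β β' : ℝ) (n : ℕ), βc ≤ β → (L : ℝ) * a β ≤ ℓc →
      1 ≤ n → 8 * n ≤ L → L' = 2 * L → 2 * a β' = a β →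
        |skewRatioT r L' β' (2 * n) - skewRatioT r L β n| ≤ ε n)
    (B n₀ k : ℕ) (hB : 0 < B) (h8 : 8 * n₀ ≤ B) (hn₀ : 1 ≤ n₀) (β : ℝ) (βj : ℕ → ℝ)
    (hβj : ∀ i, i ≤ k → βc ≤ βj i ∧ a (βj i) = a β * 2 ^ (k - i))
    (hfemto : (2 : ℝ) ^ k * B * a β ≤ ℓc) :
    haveI : ∀ i : ℕ, NeZero (2 ^ i * B) := fun i => ⟨(Nat.mul_pos (Nat.pow_pos (by norm_num)) hB).ne'⟩
    |skewRatioT r (2 ^ k * B) (βj k) (2 ^ k * n₀) - skewRatioT r (2 ^ 0 * B) (βj 0) (2 ^ 0 * n₀)| ≤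
      ∑ i ∈ Finset.range k, ε (2 ^ i * n₀) := by
  haveI : ∀ i : ℕ, NeZero (2 ^ i * B) := fun i => ⟨(Nat.mul_pos (Nat.pow_pos (by norm_num)) hB).ne'⟩
  refine abs_sub_le_sum_of_steps (fun i => skewRatioT r (2 ^ i * B) (βj i) (2 ^ i * n₀)) _ k ?_
  intro i hi
  obtain ⟨hβi, hai⟩ := hβj i hi.le
  obtain ⟨-, hai1⟩ := hβj (i + 1) hi
  have hL' : 2 ^ (i + 1) * B = 2 * (2 ^ i * B) := by ring
  have ha2 : 2 * a (βj (i + 1)) = a (βj i) := by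
    rw [hai, hai1, show k - i = (k - (i + 1)) + 1 by omega, pow_succ]; ring
  have hfem : ((2 ^ i * B : ℕ) : ℝ) * a (βj i) ≤ ℓc := by
    rw [hai]
    have : ((2 ^ i * B : ℕ) : ℝ) * (a β * 2 ^ (k - i)) = (2 : ℝ) ^ k * B * a β := by
      push_cast
      rw [show (2 : ℝ) ^ k = 2 ^ i * 2 ^ (k - i) by rw [← pow_add]; congr 1; omega]
      ring
    rw [this]; exact hfemto
  have h := hstep (2 ^ i * B) (2 ^ (i + 1) * B) (βj i) (βj (i + 1)) (2 ^ i * n₀) hβi hfem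
    (Nat.le_trans hn₀ (Nat.le_mul_of_pos_left n₀ (Nat.pow_pos (by norm_num))))
    (by calc 8 * (2 ^ i * n₀) = 2 ^ i * (8 * n₀) := by ring
          _ ≤ 2 ^ i * B := Nat.mul_le_mul_left _ h8) hL' ha2
  have hn : 2 * (2 ^ i * n₀) = 2 ^ (i + 1) * n₀ := by ring
  simpa [hn] using h

end Chains


/-- Dyadic bookkeeping of the separation: `k := log₂ ⌊n/N₀⌋`, `n₀ := ⌊n/2^k⌋`. -/
theorem dyadic_split {N₀ n k n₀ : ℕ} (hN₀ : 1 ≤ N₀) (hn : 1 ≤ n) (hk : k = Nat.log 2 (n / N₀))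
    (hn₀ : n₀ = n / 2 ^ k) :
    2 ^ k ≤ n ∧ n < 2 ^ (k + 1) * N₀ ∧ 1 ≤ n₀ ∧ n₀ < 2 * N₀ ∧ (k = 0 ∨ N₀ ≤ n₀) ∧
      2 ^ k * n₀ ≤ n ∧ n < 2 ^ k * n₀ + 2 ^ k := by
  have h2k : 0 < 2 ^ k := Nat.pow_pos (by norm_num)
  have hN₀pos : 0 < N₀ := hN₀
  -- 2^k ≤ n and n < 2^(k+1) N₀, and the dichotomy
  have hA : 2 ^ k ≤ n ∧ n < 2 ^ (k + 1) * N₀ ∧ (k = 0 ∨ N₀ * 2 ^ k ≤ n) := by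
    by_cases hnN : n < N₀
    · have h0 : n / N₀ = 0 := Nat.div_eq_of_lt hnN
      have hk0 : k = 0 := by rw [hk, h0, Nat.log_zero_right]
      subst hk0
      refine ⟨by simpa using hn, ?_, Or.inl rfl⟩
      calc n < N₀ := hnN
        _ ≤ 2 ^ (0 + 1) * N₀ := by omega
    · have hle : N₀ ≤ n := not_lt.1 hnN
      have hm : n / N₀ ≠ 0 := (Nat.div_pos hle hN₀pos).ne'
      have h1 : 2 ^ k ≤ n / N₀ := hk ▸ Nat.pow_log_le_self 2 hm
      have h2 : n / N₀ < 2 ^ (k + 1) := hk ▸ Nat.lt_pow_succ_log_self (by norm_num) _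
      have h3 : 2 ^ k * N₀ ≤ n := (Nat.le_div_iff_mul_le hN₀pos).1 h1
      refine ⟨h1.trans (Nat.div_le_self _ _), ?_, Or.inr (by simpa [Nat.mul_comm] using h3)⟩
      have h4 : n < n / N₀ * N₀ + N₀ := Nat.lt_div_mul_add hN₀pos
      calc n < n / N₀ * N₀ + N₀ := h4
        _ = (n / N₀ + 1) * N₀ := by ring
        _ ≤ 2 ^ (k + 1) * N₀ := Nat.mul_le_mul_right _ h2
  obtain ⟨h1, h2, h3⟩ := hA
  have hn₀1 : 1 ≤ n₀ := by
    rw [hn₀]; exact (Nat.le_div_iff_mul_le h2k).2 (by simpa using h1)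
  have hn₀lt : n₀ < 2 * N₀ := by
    rw [hn₀]; apply (Nat.div_lt_iff_lt_mul h2k).2
    calc n < 2 ^ (k + 1) * N₀ := h2
      _ = 2 * N₀ * 2 ^ k := by ring
  have hdich : k = 0 ∨ N₀ ≤ n₀ := by
    rcases h3 with h | h
    · exact Or.inl h
    · right; rw [hn₀]; exact (Nat.le_div_iff_mul_le h2k).2 h
  have h5 : 2 ^ k * n₀ ≤ n := by rw [hn₀]; exact Nat.mul_div_le n (2 ^ k)
  have h6 : n < 2 ^ k * n₀ + 2 ^ k := by
    rw [hn₀]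
    have := Nat.lt_div_mul_add (a := n) h2k
    linarith [Nat.mul_comm (n / 2 ^ k) (2 ^ k)]
  exact ⟨h1, h2, hn₀1, hn₀lt, hdich, h5, h6⟩

end Summit.QuantumFields.YangMills.Cruxes.FemtoCurvatureSkewnessC.RatioTransport

end
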